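import Literature.AnabelianGeometry.EtaleTheta.SettingModelTateOriginShearRigidity
import HarnessLib

/-!
# SHEAR RIGIDITY of the Tate-module clause at stage 2, level `4`: `IsTateOrigin` at `ThetaSetting.modelχq p i j hj`
# forces `j = 2 ∨ j = −2`

abc-iut cell, layer L2, R78 cluster STAGE 2 (integrator abc-iut-L6-d6), seat abc-iut-w5-d051 (gen 3; sequel of
`SettingModelTateOriginShearRigidity`: there every ODD prime factor of the shear exponent `j` is excluded, leaving
`|j| = 2^a`, `a ≥ 1`). Mochizuki, *The étale theta function …*, Publ. RIMS **45** (2009) [EtTh], §1 p. 13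
[cite: MochizukiEtTh2009, §1 p.13]: «`G_{K_N}` acts trivially on `(Δ^tp_X)^ell/N·(Δ^tp_Y)^ell`», `K_N = K(ζ_N, q_X^{1/N})`.

* §1 the level-`4` Galois input `exists_gal_fix_zeta_move_fourthRoot`: some `σ ∈ G_{ℚ_p}` fixes a primitive `4`-th
  root of unity `ζ` and moves any `4`-th root `r` of `p²`. Elementary: `r² = ±p`, so `[ℚ_p(r) : ℚ_p] = 2`
  (`±p` is no square, `v_p` odd) while `[ℚ_p(ζ) : ℚ_p] ≤ φ(4) = 2`; if `r ∈ ℚ_p(ζ)` then `ℚ_p(r) = ℚ_p(ζ) ∋ ζ = a + b r`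
  and `ζ² = −1` gives `2ab·r ∈ ℚ_p`: `ab ≠ 0` puts `r ∈ ℚ_p`; `b = 0` puts `ζ`, hence `r`, in `ℚ_p`; `a = 0` gives
  `b²·(±p) = −1`, of odd valuation — all absurd (this covers `p = 2`, where `ℚ_2(ζ_4)` IS ramified, as well);
* §2 **`modelχq_not_isTateOrigin_of_four_dvd`** (`4 ∣ j ⇒ ✗`, the core `modelχq_not_isTateOrigin_of_dvd_of_gal` at
  `N = 4`) and **`eq_two_or_neg_two_of_isTateOrigin`**: `(modelχq p i j hj).IsTateOrigin → j = 2 ∨ j = −2`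
  (with `natAbs_eq_two_pow_of_isTateOrigin`); `modelχq_isTateOrigin_only_if_and_two` pairs it with the designated
  inhabitant `SettingModelTateOrigin.modelχq_isTateOrigin` (`j = 2`). The converse at `j = −2` (same proof as `j = 2`
  with `ζ_N ↦ ζ_N⁻¹`, i.e. the opposite orientation of `Ẑ(1)`) is not in this file.

READING: at stage 2 the print-faithful Tate clause determines the shear exponent up to the orientation sign:
`|j| = 2 = v_p(q_X)`. PROOF-ONLY (no definition, no named fact). Semi-synthetic model = consistency evidence only;
nothing of [EtTh] asserted for genuine tempered fundamental groups; no side is taken on [IUTchIII] Cor. 3.12;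
typed ≠ proved.
-/

noncomputable section

namespace Literature.AnabelianGeometry.EtaleTheta.SettingModel

open Literature.AnabelianGeometry.SemiGraphs Thm16Sub Function Topology Polynomial

/-! ### 1. Galois input at level `4` -/

section Galois

variable (p : ℕ) [Fact p.Prime]

/-- An element `c ∈ ℚ_p` of valuation `1` is not a square, and `b²·c ≠ −1` (parity of `v_p`).
[cite: Gouvea1993PadicNumbers, Prop 6.3.11] -/
private theorem padic_val_one_obstructions {c : ℚ_[p]} (hc0 : c ≠ 0) (hcv : c.valuation = 1) (b : ℚ_[p]) :
    b ^ 2 ≠ c ∧ b ^ 2 * c ≠ -1 := by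
  have hm1 : (-1 : ℚ_[p]).valuation = 0 := by
    have h := Padic.valuation_pow (-1 : ℚ_[p]) 2
    rw [neg_one_sq, Padic.valuation_one] at h
    omega
  constructor
  · intro h
    have hb : b ≠ 0 := by
      rintro rfl
      rw [zero_pow two_ne_zero] at h
      exact hc0 h.symm
    have hv := congrArg Padic.valuation h
    rw [Padic.valuation_pow, hcv] at hv
    omega
  · intro h
    have hb : b ≠ 0 := by
      rintro rfl
      rw [zero_pow two_ne_zero, zero_mul] at h
      exact one_ne_zero (neg_eq_zero.mp h.symm)
    have hv := congrArg Padic.valuation h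
    rw [Padic.valuation_mul (pow_ne_zero 2 hb) hc0, Padic.valuation_pow, hcv, hm1] at hv
    omega

/-- A fourth root of `p²` squares to `p` or to `−p`. [cite: MilneFT2022, Prop 1.25] -/
private theorem sq_eq_or_of_pow_four_eq {r : PadicAlgCl p} (hr : r ^ 4 = ((p : ℕ) : PadicAlgCl p) ^ 2) :
    r ^ 2 = ((p : ℕ) : PadicAlgCl p) ∨ r ^ 2 = -((p : ℕ) : PadicAlgCl p) := by
  have h : (r ^ 2 - (p : PadicAlgCl p)) * (r ^ 2 + (p : PadicAlgCl p)) = 0 := by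
    linear_combination hr
  rcases mul_eq_zero.mp h with h | h
  · exact Or.inl (sub_eq_zero.mp h)
  · exact Or.inr (eq_neg_of_add_eq_zero_left h)

/-- The datum behind a fourth root `r` of `p²`: `r² = c` for some `c ∈ {p, −p} ⊆ ℚ_p` of valuation `1`.
[cite: Gouvea1993PadicNumbers, Prop 6.3.11] -/
private theorem exists_sq_eq_algebraMap_of_pow_four_eq {r : PadicAlgCl p} (hr : r ^ 4 = ((p : ℕ) : PadicAlgCl p) ^ 2) :
    ∃ c : ℚ_[p], c ≠ 0 ∧ c.valuation = 1 ∧ r ^ 2 = algebraMap ℚ_[p] (PadicAlgCl p) c := by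
  have hp : (p : ℚ_[p]) ≠ 0 := Nat.cast_ne_zero.mpr (Fact.out : p.Prime).ne_zero
  have hm1 : (-1 : ℚ_[p]).valuation = 0 := by
    have h := Padic.valuation_pow (-1 : ℚ_[p]) 2
    rw [neg_one_sq, Padic.valuation_one] at h
    omega
  rcases sq_eq_or_of_pow_four_eq p hr with h | h
  · exact ⟨p, hp, Padic.valuation_p, by rw [h, map_natCast]⟩
  · refine ⟨-p, neg_ne_zero.mpr hp, ?_, by rw [h, map_neg, map_natCast]⟩
    rw [← neg_one_mul, Padic.valuation_mul (by norm_num) hp, hm1, Padic.valuation_p, zero_add]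

/-- `[ℚ_p(r) : ℚ_p] = 2` when `r² = c` with `c` no square in `ℚ_p`. [cite: MilneFT2022, Prop 1.25] -/
private theorem finrank_adjoin_sqrt {c : ℚ_[p]} (hc : ∀ b : ℚ_[p], b ^ 2 ≠ c) {r : PadicAlgCl p}
    (hr : r ^ 2 = algebraMap ℚ_[p] (PadicAlgCl p) c) :
    Module.finrank ℚ_[p] (IntermediateField.adjoin ℚ_[p] {r}) = 2 := by
  have hint : IsIntegral ℚ_[p] r := Algebra.IsIntegral.isIntegral r
  let P : ℚ_[p][X] := X ^ 2 - C c
  have hPm : P.Monic := monic_X_pow_sub_C _ two_ne_zero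
  have hPdeg : P.natDegree = 2 := natDegree_X_pow_sub_C
  have hPr : Polynomial.aeval r P = 0 := by
    simp only [P, map_sub, map_pow, aeval_X, aeval_C]
    rw [hr, sub_self]
  have hirr : Irreducible P := X_pow_sub_C_irreducible_of_prime Nat.prime_two hc
  have hmin : P = minpoly ℚ_[p] r := minpoly.eq_of_irreducible_of_monic hirr hPr hPm
  rw [IntermediateField.adjoin.finrank hint, ← hmin, hPdeg]

/-- `[ℚ_p(ζ) : ℚ_p] ≤ φ(n)` for a primitive `n`-th root of unity (`ζ` is a root of `Φ_n`). [cite: MilneFT2022, Prop 1.25] -/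
private theorem finrank_adjoin_zeta_le_totient {n : ℕ} (hn : 0 < n) {ζ : PadicAlgCl p} (hζ : IsPrimitiveRoot ζ n) :
    Module.finrank ℚ_[p] (IntermediateField.adjoin ℚ_[p] {ζ}) ≤ Nat.totient n := by
  have hint : IsIntegral ℚ_[p] ζ := Algebra.IsIntegral.isIntegral ζ
  have hroot : Polynomial.aeval ζ (cyclotomic n ℚ_[p]) = 0 := by
    rw [aeval_def, eval₂_eq_eval_map, map_cyclotomic, ← IsRoot.def]
    exact hζ.isRoot_cyclotomic hn
  have hdeg := minpoly.min ℚ_[p] ζ (cyclotomic.monic n ℚ_[p]) hroot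
  rw [IntermediateField.adjoin.finrank hint]
  calc (minpoly ℚ_[p] ζ).natDegree ≤ (cyclotomic n ℚ_[p]).natDegree := natDegree_le_natDegree hdeg
    _ = Nat.totient n := natDegree_cyclotomic n ℚ_[p]

/-- Elements of `ℚ_p(r)`, `r² = c ∈ ℚ_p`, are `a + b·r`. [cite: MilneFT2022, Prop 1.25] -/
private theorem exists_eq_add_mul_of_mem_adjoin_sqrt {c : ℚ_[p]} {r x : PadicAlgCl p}
    (hr : r ^ 2 = algebraMap ℚ_[p] (PadicAlgCl p) c) (hx : x ∈ IntermediateField.adjoin ℚ_[p] {r}) :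
    ∃ a b : ℚ_[p], x = algebraMap ℚ_[p] (PadicAlgCl p) a + algebraMap ℚ_[p] (PadicAlgCl p) b * r := by
  have hrint : IsIntegral ℚ_[p] r := Algebra.IsIntegral.isIntegral r
  have h1 : x ∈ (IntermediateField.adjoin ℚ_[p] {r}).toSubalgebra := hx
  rw [IntermediateField.adjoin_simple_toSubalgebra_of_isAlgebraic hrint.isAlgebraic,
    Algebra.adjoin_singleton_eq_range_aeval] at h1
  obtain ⟨f, hf⟩ := h1
  let P : ℚ_[p][X] := X ^ 2 - C c
  have hPm : P.Monic := monic_X_pow_sub_C _ two_ne_zero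
  have hPdeg : P.natDegree = 2 := natDegree_X_pow_sub_C
  have hPr : Polynomial.aeval r P = 0 := by
    simp only [P, map_sub, map_pow, aeval_X, aeval_C]
    rw [hr, sub_self]
  have hP1 : P ≠ 1 := by
    intro h1
    have h := congrArg natDegree h1
    rw [hPdeg, natDegree_one] at h
    exact two_ne_zero h
  set g : ℚ_[p][X] := f %ₘ P with hg
  have hnat : g.natDegree < 2 := by
    have h := natDegree_modByMonic_lt f hPm hP1
    rwa [hPdeg] at h
  have hform := eq_X_add_C_of_degree_le_one (degree_le_of_natDegree_le (Nat.lt_succ_iff.mp hnat))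
  refine ⟨g.coeff 0, g.coeff 1, ?_⟩
  rw [← hf]
  change Polynomial.aeval r f = _
  rw [← aeval_modByMonic_eq_self_of_root hPr (p := f), ← hg]
  conv_lhs => rw [hform]
  simp only [map_add, map_mul, aeval_C, aeval_X]
  ring

/-- **Some `σ ∈ G_{ℚ_p}` fixes `ζ_4` and moves `(p²)^{1/4}`** (every `p`, including `p = 2`).
[cite: MilneFT2022, Thm 7.13] -/
theorem exists_gal_fix_zeta_move_fourthRoot {ζ r : PadicAlgCl p} (hζ : IsPrimitiveRoot ζ 4)
    (hr : r ^ 4 = ((p : ℕ) : PadicAlgCl p) ^ 2) : ∃ σ : GQp p, σ ζ = ζ ∧ σ r ≠ r := by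
  by_contra hall
  push Not at hall
  haveI : IsGalois ℚ_[p] (PadicAlgCl p) := {}
  have hmem : r ∈ IntermediateField.fixedField (IntermediateField.adjoin ℚ_[p] {ζ}).fixingSubgroup := by
    rw [IntermediateField.mem_fixedField_iff]
    intro σ hσ
    have hσζ : σ ζ = ζ :=
      (IntermediateField.mem_fixingSubgroup_iff _ σ).mp hσ ζ (IntermediateField.mem_adjoin_simple_self _ ζ)
    exact hall σ hσζ
  rw [InfiniteGalois.fixedField_fixingSubgroup] at hmem
  -- `r² = c`, `c = ±p`
  obtain ⟨c, hc0, hcv, hrc⟩ := exists_sq_eq_algebraMap_of_pow_four_eq p hr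
  have hobs := fun b => padic_val_one_obstructions p hc0 hcv b
  have hinj := (algebraMap ℚ_[p] (PadicAlgCl p)).injective
  -- `ℚ_p(r) = ℚ_p(ζ)` by degrees
  have hζint : IsIntegral ℚ_[p] ζ := Algebra.IsIntegral.isIntegral ζ
  haveI := IntermediateField.adjoin.finiteDimensional hζint
  have hle : IntermediateField.adjoin ℚ_[p] {r} ≤ IntermediateField.adjoin ℚ_[p] {ζ} :=
    IntermediateField.adjoin_simple_le_iff.mpr hmem
  have hr2 : Module.finrank ℚ_[p] (IntermediateField.adjoin ℚ_[p] {r}) = 2 :=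
    finrank_adjoin_sqrt p (fun b => (hobs b).1) hrc
  have hζ2 : Module.finrank ℚ_[p] (IntermediateField.adjoin ℚ_[p] {ζ}) ≤ 2 :=
    (finrank_adjoin_zeta_le_totient p (by norm_num) hζ).trans (by decide)
  have heq : IntermediateField.adjoin ℚ_[p] {r} = IntermediateField.adjoin ℚ_[p] {ζ} :=
    IntermediateField.eq_of_le_of_finrank_le hle (hζ2.trans hr2.ge)
  have hζmem : ζ ∈ IntermediateField.adjoin ℚ_[p] {r} := by
    rw [heq]
    exact IntermediateField.mem_adjoin_simple_self _ ζ
  -- `ζ = a + b r` with `ζ² = −1`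
  obtain ⟨a, b, hab⟩ := exists_eq_add_mul_of_mem_adjoin_sqrt p hrc hζmem
  have hζsq : ζ ^ 2 = -1 := by
    have h4 : (ζ ^ 2 - 1) * (ζ ^ 2 + 1) = 0 := by linear_combination hζ.pow_eq_one
    rcases mul_eq_zero.mp h4 with h | h
    · exact absurd (sub_eq_zero.mp h) (hζ.pow_ne_one_of_pos_of_lt (by norm_num) (by norm_num))
    · exact eq_neg_of_add_eq_zero_left h
  have hexp : 2 * algebraMap ℚ_[p] (PadicAlgCl p) a * algebraMap ℚ_[p] (PadicAlgCl p) b * r =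
      -1 - algebraMap ℚ_[p] (PadicAlgCl p) a ^ 2 - algebraMap ℚ_[p] (PadicAlgCl p) b ^ 2 *
        algebraMap ℚ_[p] (PadicAlgCl p) c := by
    rw [hab] at hζsq
    linear_combination hζsq - algebraMap ℚ_[p] (PadicAlgCl p) b ^ 2 * hrc
  by_cases hb : b = 0
  · -- `ζ ∈ ℚ_p`, so `ℚ_p(ζ) = ℚ_p ∋ r`: `r² = c` would be a square in `ℚ_p`
    have hζbot : ζ ∈ (⊥ : IntermediateField ℚ_[p] (PadicAlgCl p)) := by
      rw [IntermediateField.mem_bot]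
      exact ⟨a, by rw [hab, hb, map_zero, zero_mul, add_zero]⟩
    have hrbot : r ∈ (⊥ : IntermediateField ℚ_[p] (PadicAlgCl p)) := by
      rw [← IntermediateField.adjoin_simple_eq_bot_iff.mpr hζbot]
      exact hmem
    obtain ⟨d, hd⟩ := IntermediateField.mem_bot.mp hrbot
    refine (hobs d).1 (hinj ?_)
    rw [map_pow, hd, hrc]
  by_cases ha : a = 0
  · -- `ζ = b r`: `b² c = −1` in `ℚ_p`
    refine (hobs b).2 (hinj ?_)
    rw [map_mul, map_pow, map_neg, map_one, ← hζsq, hab, ha, map_zero, zero_add, mul_pow, hrc]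
  · -- `ab ≠ 0`: `r ∈ ℚ_p`
    have hden : (2 * a * b : ℚ_[p]) ≠ 0 := mul_ne_zero (mul_ne_zero two_ne_zero ha) hb
    have hd : algebraMap ℚ_[p] (PadicAlgCl p) ((-1 - a ^ 2 - b ^ 2 * c) / (2 * a * b)) = r := by
      rw [map_div₀, div_eq_iff ((_root_.map_ne_zero _).mpr hden)]
      simp only [map_sub, map_neg, map_one, map_mul, map_pow, map_ofNat]
      rw [← hexp]
      ring
    refine (hobs ((-1 - a ^ 2 - b ^ 2 * c) / (2 * a * b))).1 (hinj ?_)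
    rw [map_pow, hd, hrc]

end Galois

/-! ### 2. The shear exponent is `±2` -/

section Model

variable (p : ℕ) [Fact p.Prime] (i j : ℤ) (hj : Even j)

/-- **`4 ∣ j ⇒ ✗`**: the print-faithful Tate-module clause fails at `modelχq p i j` whenever `4` divides the shear
exponent (the core of `SettingModelTateOriginShearRigidity` at level `N = 4`). [cite: MochizukiEtTh2009, §1 p.13] -/
theorem modelχq_not_isTateOrigin_of_four_dvd (h4 : (4 : ℤ) ∣ j) : ¬ (ThetaSetting.modelχq p i j hj).IsTateOrigin :=
  modelχq_not_isTateOrigin_of_dvd_of_gal p i j hj 4 (by exact_mod_cast h4) fun _ _ hζ hr =>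
    exists_gal_fix_zeta_move_fourthRoot p hζ hr

/-- **`IsTateOrigin ⇒ j = 2 ∨ j = −2`.** The Tate-module clause pins the shear exponent of the stage-2 model up to
the orientation sign: `|j| = 2 = v_p(q_X)`. [cite: MochizukiEtTh2009, §1 p.13] -/
theorem eq_two_or_neg_two_of_isTateOrigin (h : (ThetaSetting.modelχq p i j hj).IsTateOrigin) : j = 2 ∨ j = -2 := by
  obtain ⟨a, ha0, ha⟩ := natAbs_eq_two_pow_of_isTateOrigin p i j hj h
  have ha1 : a = 1 := by
    by_contra ha1
    have h2a : 2 ≤ a := by omega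
    obtain ⟨k, rfl⟩ := Nat.exists_eq_add_of_le h2a
    have h4 : (4 : ℤ) ∣ j := by
      have h4' : 4 ∣ j.natAbs := by
        rw [ha, pow_add]
        exact Dvd.intro _ rfl
      exact Int.ofNat_dvd_left.mpr h4'
    exact modelχq_not_isTateOrigin_of_four_dvd p i j hj h4 h
  rw [ha1, pow_one] at ha
  exact Int.natAbs_eq_iff.mp ha

/-- **Summary (NV register)**: `IsTateOrigin` at the stage-2 family holds at the designated shear `j = 2` (every `i`)
and ONLY IF `j = ±2`. [cite: MochizukiEtTh2009, §1 p.13] -/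
theorem modelχq_isTateOrigin_only_if_and_two :
    (∀ i : ℤ, (ThetaSetting.modelχq p i 2 even_two).IsTateOrigin) ∧
      (∀ (i j : ℤ) (hj : Even j), (ThetaSetting.modelχq p i j hj).IsTateOrigin → j = 2 ∨ j = -2) :=
  ⟨modelχq_isTateOrigin p, fun i j hj h => eq_two_or_neg_two_of_isTateOrigin p i j hj h⟩

end Model

end Literature.AnabelianGeometry.EtaleTheta.SettingModel

end
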